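import Summits.Ventures.CertifiedManyBodySolver.Observables.PinningFieldChords
import Literature.MathematicalPhysics.QuantumLattice.HubbardNNNHoppingTorusLimitCorrelator
import HarnessLib

/-!
# Pinning-field response menu (III): READERS — leaves ⇒ the thermodynamic-limit stair and `dWaveOrderParameterTT'`;
# today's input at ANY `t'` = the source-free cap from a certified CANONICAL upper row (Legendre); the B-row reading

HONEST FRAMING: first certified bounds on pairing observables; zero compute; nothing in this file is a number; every
statement takes certified rows / leaves as hypotheses; a finite-`h` response is not an order parameter and not a phase
word; an order-parameter CEILING never speaks to presence; not a superconductivity verdict.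

Cell `hubbard-obs` (D-0042 / D-0082 (c-2)), seat `hubbard-obs-pin-1` (`prover-hubbard-obs-pin-1-g0-0`); sequel of
`PinningFieldChords.lean` (row class); the stair levers are cq-obsth-3's (`DWaveSourceNNNHoppingOrderParameter`,
`SourcedOrderParameterFloorTTPrime`). CONTENTS:

* §4b leaf READERS: a floor leaf on all sides (`q = 1`) floors the stair, `m ≤ liminf_L m_{L+1}(h)`
  (`PinFieldResponseFloorAt.le_liminf` — the one-stair object a finite-`h` response-to-LRO inequality would consume, cell
  `hubbard-cq`); a ceiling leaf along ANY side progression `q ≥ 1` caps the stair (`….liminf_le`, frequently suffices;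
  `….limsup_le` for `q = 1`) and hence the ORDER PARAMETER at every `h > 0` (`PinFieldResponseCeilingAt.dWaveOrderParameterTT'_le`);
  floor leaves at ALL fields `h ∈ (0, h₀)` floor the order parameter (`le_dWaveOrderParameterTT'_of_floorAt`) — one field
  alone floors nothing about it (the staircase is an infimum; obstruction O2 of hubbard-cq START-HERE verbatim).
* §5 today's input at any anchor `(U, n, t')`, zero compute: the Legendre inequality on the finite `t–t'` torus
  (`groundEnergy_dWaveSourceTorusTT'_zero_le_sector`: `E₀(A_L(0)) ≤ E₀(L; rectN n L) − μ·rectN n L`) and its thermodynamic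
  limit (`exists_sourcedEnergyUpperRow_zero_of_canonical_upper`: a certified canonical cap `energyDensityTT' 1 tp U n ≤ hiTL`
  and any rational `hi > hiTL − μn` give `∃ L₀, SourcedEnergyUpperRow tp U μ 0 1 L₀ hi`, hence a cap row at EVERY field
  `h ≥ 0`, `…_of_canonical_upper`) — the `t–t'` twin, in ROW vocabulary, of obs-p1's `eventually_groundEnergy_dWaveSourceTorus_zero_le`;
  and the B-ROW READING `PinFieldResponseCeilingAt.of_canonical_upper_of_sourcedLower`: canonical cap + ONE sourced floor row
  at `h₂ > h` ⇒ ceiling leaf at `h` (and the order-parameter ceiling for `h > 0`). By the honesty node of (II) this input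
  never feeds the FLOOR edge.

No definition, no named fact, no `sorry`.

References: T. Koma, H. Tasaki, J. Stat. Phys. 76 (1994) 745, §1 [KomaTasaki1994]; D. Ruelle, Statistical Mechanics (1969)
§3.4 [Ruelle1969]; H. Tasaki, Physics and Mathematics of Quantum Many-Body Systems (2020) §2.1 [Tasaki2020].
-/

noncomputable section

namespace Summit.Ventures.CertifiedManyBodySolver.Observables

open Matrix Literature.MathematicalPhysics.QuantumLattice Literature.Probability.LatticeModels
open Literature.Barriers.HubbardSuperconductivity
open Filter Topology Finset
open scoped Matrix.Norms.L2Operator ComplexOrder BigOperators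

open Summit.Ventures.CertifiedManyBodySolver

/-! ### §4b Leaf readers: the stair and the order parameter -/

section Readers

variable {tp U μ} {h : ℝ} {q L₀ : ℕ} {m M : ℚ}

/-- **Floor leaf (all sides, `q = 1`) ⇒ stair floor**: `m ≤ liminf_L m_{L+1}(h)` — the one-stair object a finite-`h`
response-to-LRO inequality would consume (cell `hubbard-cq`). [cite: KomaTasaki1994, §1] -/
theorem PinFieldResponseFloorAt.le_liminf (hF : PinFieldResponseFloorAt tp U μ h 1 L₀ m) :
    ((m : ℚ) : ℝ) ≤ liminf (fun L : ℕ => dWaveSourceDensityTT' (L + 1) tp U μ h) atTop := by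
  refine le_liminf_of_le (isBoundedUnder_le_dWaveSourceDensityTT' tp U μ h).isCoboundedUnder_ge ?_
  filter_upwards [eventually_ge_atTop L₀] with L hL
  exact hF (L + 1) (hL.trans (Nat.le_succ L)) (one_dvd _)

/-- **Ceiling leaf (all sides) ⇒ stair ceiling in `limsup` form**: `limsup_L m_{L+1}(h) ≤ M`. [cite: KomaTasaki1994, §1] -/
theorem PinFieldResponseCeilingAt.limsup_le (hC : PinFieldResponseCeilingAt tp U μ h 1 L₀ M) :
    limsup (fun L : ℕ => dWaveSourceDensityTT' (L + 1) tp U μ h) atTop ≤ ((M : ℚ) : ℝ) := by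
  refine limsup_le_of_le (isBoundedUnder_ge_dWaveSourceDensityTT' tp U μ h).isCoboundedUnder_le ?_
  filter_upwards [eventually_ge_atTop L₀] with L hL
  exact hC (L + 1) (hL.trans (Nat.le_succ L)) (one_dvd _)

/-- **Ceiling leaf along ANY side progression `q ≥ 1` ⇒ stair ceiling**: `liminf_L m_{L+1}(h) ≤ M` (the leaf holds
frequently in `L`, which is all a `liminf` ceiling needs). [cite: KomaTasaki1994, §1] -/
theorem PinFieldResponseCeilingAt.liminf_le (hC : PinFieldResponseCeilingAt tp U μ h q L₀ M) (hq : 0 < q) :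
    liminf (fun L : ℕ => dWaveSourceDensityTT' (L + 1) tp U μ h) atTop ≤ ((M : ℚ) : ℝ) := by
  refine liminf_le_of_frequently_le ?_ (isBoundedUnder_ge_dWaveSourceDensityTT' tp U μ h)
  rw [frequently_atTop]
  intro N
  have h1 : 1 ≤ q * (N + L₀ + 1) := Nat.mul_pos hq (Nat.succ_pos _)
  have h2 : N + L₀ + 1 ≤ q * (N + L₀ + 1) := Nat.le_mul_of_pos_left _ hq
  refine ⟨q * (N + L₀ + 1) - 1, by omega, ?_⟩
  have hidx : q * (N + L₀ + 1) - 1 + 1 = q * (N + L₀ + 1) := Nat.sub_add_cancel h1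
  exact hC (q * (N + L₀ + 1) - 1 + 1) (by omega) ⟨N + L₀ + 1, hidx⟩

/-- **Ceiling leaf at one field `h > 0` ⇒ ORDER-PARAMETER CEILING**: `dWaveOrderParameterTT' tp U μ ≤ M` (any side
progression `q ≥ 1`). A ceiling; never speaks to presence. [cite: KomaTasaki1994, §1] -/
theorem PinFieldResponseCeilingAt.dWaveOrderParameterTT'_le (hC : PinFieldResponseCeilingAt tp U μ h q L₀ M)
    (hq : 0 < q) (hh : 0 < h) : dWaveOrderParameterTT' tp U μ ≤ ((M : ℚ) : ℝ) :=
  (dWaveOrderParameterTT'_le_liminf tp U μ hh).trans (hC.liminf_le hq)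

/-- **Floor leaves at ALL small fields ⇒ ORDER-PARAMETER FLOOR** (`q = 1`): if every `h ∈ (0, h₀)` carries a floor
leaf `m`, then `m ≤ dWaveOrderParameterTT' tp U μ`. ONE field alone floors nothing about the order parameter (the
staircase is an infimum over all `h > 0`): this is the `h`-uniformity a finite-`h` instrument must supply.
[cite: KomaTasaki1994, §1] -/
theorem le_dWaveOrderParameterTT'_of_floorAt {h₀ : ℝ} (hh₀ : 0 < h₀)
    (H : ∀ h ∈ Set.Ioo 0 h₀, ∃ L₀ : ℕ, PinFieldResponseFloorAt tp U μ h 1 L₀ m) :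
    ((m : ℚ) : ℝ) ≤ dWaveOrderParameterTT' tp U μ :=
  le_dWaveOrderParameterTT'_of_forall tp U μ hh₀ fun h hh => by
    obtain ⟨L₀, hF⟩ := H h hh
    exact hF.le_liminf

end Readers

/-! ### §5 Today's input at ANY `t'`: the source-free CAP from a certified CANONICAL upper row (Legendre) -/

section Legendre

open Literature.MathematicalPhysics.QuantumLattice.ThermodynamicLimit

/-- **Legendre inequality on a finite torus, `t–t'`**: for `0 ≤ n ≤ 2`,
`E₀(A_L(0)) = E₀(H^{tt'}_L − μN) ≤ E₀(L; rectN n L) − μ · rectN n L` (Rayleigh quotient of a unit ground state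
of the sector `(rectN n L, S^z = 0)` of `hubbardTorusTT' L 1 tp U`, on which `N̂ = rectN n L`). [cite: Tasaki2020, §2.1] -/
theorem groundEnergy_dWaveSourceTorusTT'_zero_le_sector (L : ℕ) [NeZero L] (tp U μ : ℝ) {n : ℝ}
    (hn0 : 0 ≤ n) (hn2 : n ≤ 2) :
    (dWaveSourceTorusTT' L tp U μ 0).groundEnergy ≤
      Literature.MathematicalPhysics.QuantumLattice.groundEnergy (hubbardTorusTT' L 1 tp U) (rectN n L) - μ * (rectN n L : ℝ) := by
  obtain ⟨ψ, hψ, h1⟩ := exists_unit_isGroundStateInSector_hubbardTorusTT' L 1 tp U hn0 hn2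
  have hray := Matrix.groundEnergy_le_rayleigh_holds (dWaveSourceTorusTT'_isHermitian L tp U μ 0) ψ h1
  have hN : IsNParticle (rectN n L) ψ := ((mem_szSector_iff _ _ _).1 hψ.1).1
  have hE := re_rayleigh_hubbardTorusTT'_of_isGroundStateInSector_rectN L 1 tp U hn0 hn2 hψ h1
  have hsplit : (star ψ ⬝ᵥ (dWaveSourceTorusTT' L tp U μ 0 *ᵥ ψ)).re =
      (star ψ ⬝ᵥ (hubbardTorusTT' L 1 tp U *ᵥ ψ)).re - μ * (rectN n L : ℝ) := by
    rw [dWaveSourceTorusTT'_zero_source, sub_mulVec, smul_mulVec, totalNumber_mulVec_of_isNParticle hN,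
      dotProduct_sub, dotProduct_smul, dotProduct_smul, h1, Complex.sub_re, smul_eq_mul, smul_eq_mul, mul_one]
    simp
  rw [hsplit, hE] at hray
  exact hray

/-- **The source-free cap from a canonical TL upper row, `t–t'`** (zero compute): for `U ≥ 0`, `0 ≤ n < 2`, a certified
`energyDensityTT' 1 tp U n ≤ hiTL` (an M3-class UPPER row at `(U, n, t')`), any `μ`, and any rational `hi > hiTL − μ·n`:
`∃ L₀, SourcedEnergyUpperRow tp U μ 0 1 L₀ hi` — and hence (`sourcedEnergyUpperRow_mono_field`) a cap at EVERY field `h ≥ 0`.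
This feeds the CEILING chord today; it can never feed the FLOOR chord (`floorSlot_nonpos_of_transported_cap`).
[cite: Ruelle1969, §3.4] [cite: Tasaki2020, §2.1] -/
theorem exists_sourcedEnergyUpperRow_zero_of_canonical_upper (tp : ℝ) {U : ℝ} (hU : 0 ≤ U) (μ : ℝ) {n : ℝ}
    (hn0 : 0 ≤ n) (hn2 : n < 2) {hiTL : ℝ} (hhi : energyDensityTT' 1 tp U n ≤ hiTL) {hi : ℚ}
    (hgt : hiTL - μ * n < hi) : ∃ L₀ : ℕ, SourcedEnergyUpperRow tp U μ 0 1 L₀ hi := by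
  have hE := tendsto_energyDensityTT'_torus 1 tp hU hn0 hn2
  have hN : Tendsto (fun L : ℕ => (rectN n L : ℝ) / (L : ℝ) ^ 2) atTop (𝓝 n) := tendsto_rectN_div_sq hn0
  have hlim : Tendsto (fun L : ℕ => Literature.MathematicalPhysics.QuantumLattice.groundEnergy (hubbardTorusTT' L 1 tp U) (rectN n L) / (L : ℝ) ^ 2 -
      μ * ((rectN n L : ℝ) / (L : ℝ) ^ 2)) atTop (𝓝 (energyDensityTT' 1 tp U n - μ * n)) := hE.sub (hN.const_mul μ)
  have hlt : energyDensityTT' 1 tp U n - μ * n < ((hi : ℚ) : ℝ) := by linarith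
  obtain ⟨L₀, hL₀⟩ := eventually_atTop.1 (hlim.eventually (gt_mem_nhds hlt))
  refine ⟨L₀, fun L _ hL _ => sourcedTorusEnergyUpperRow_iff.2 ?_⟩
  have hpos : (0 : ℝ) < (L : ℝ) ^ 2 := cast_sq_pos_of_neZero L
  have hfin := groundEnergy_dWaveSourceTorusTT'_zero_le_sector L tp U μ hn0 hn2.le
  have h' := hL₀ L hL
  have hdiv : (Literature.MathematicalPhysics.QuantumLattice.groundEnergy (hubbardTorusTT' L 1 tp U) (rectN n L) - μ * (rectN n L : ℝ)) /
      (L : ℝ) ^ 2 < ((hi : ℚ) : ℝ) := by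
    rw [sub_div, mul_div_assoc]; exact h'
  exact hfin.trans ((div_lt_iff₀ hpos).1 hdiv).le

/-- The same cap transported to every field `h ≥ 0`. [cite: KomaTasaki1994, §1] -/
theorem exists_sourcedEnergyUpperRow_of_canonical_upper (tp : ℝ) {U : ℝ} (hU : 0 ≤ U) (μ : ℝ) {n : ℝ}
    (hn0 : 0 ≤ n) (hn2 : n < 2) {hiTL : ℝ} (hhi : energyDensityTT' 1 tp U n ≤ hiTL) {hi : ℚ}
    (hgt : hiTL - μ * n < hi) {h : ℝ} (hh : 0 ≤ h) : ∃ L₀ : ℕ, SourcedEnergyUpperRow tp U μ h 1 L₀ hi := by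
  obtain ⟨L₀, hrow⟩ := exists_sourcedEnergyUpperRow_zero_of_canonical_upper tp hU μ hn0 hn2 hhi hgt
  exact ⟨L₀, sourcedEnergyUpperRow_mono_field hrow le_rfl hh⟩

/-- **B-row reading at any anchor** (ceiling edge fed today modulo ONE sourced floor certificate): a canonical TL cap
`energyDensityTT' 1 tp U n ≤ hiTL`, a rational `hi > hiTL − μn`, a sourced floor row `SourcedEnergyLowerRow tp U μ h₂ 1 L₀ lo`
at `h₂ > h ≥ 0`, and `hi − lo ≤ M·2(h₂ − h)` give the ceiling leaf at `h` and, for `h > 0`,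
`dWaveOrderParameterTT' tp U μ ≤ M`. [cite: KomaTasaki1994, §1] -/
theorem PinFieldResponseCeilingAt.of_canonical_upper_of_sourcedLower (tp : ℝ) {U : ℝ} (hU : 0 ≤ U) (μ : ℝ) {n : ℝ}
    (hn0 : 0 ≤ n) (hn2 : n < 2) {hiTL : ℝ} (hhi : energyDensityTT' 1 tp U n ≤ hiTL) {hi : ℚ}
    (hgt : hiTL - μ * n < hi) {h h₂ : ℝ} (hh : 0 ≤ h) (hlt : h < h₂) {lo M : ℚ} {L₀ : ℕ}
    (hlo : SourcedEnergyLowerRow tp U μ h₂ 1 L₀ lo) (hM : ((hi : ℚ) : ℝ) - lo ≤ ((M : ℚ) : ℝ) * (2 * (h₂ - h))) :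
    ∃ L₁ : ℕ, PinFieldResponseCeilingAt tp U μ h 1 L₁ M := by
  obtain ⟨L₁, hcap⟩ := exists_sourcedEnergyUpperRow_of_canonical_upper tp hU μ hn0 hn2 hhi hgt hh
  exact ⟨max L₁ L₀, PinFieldResponseCeilingAt.of_energyRows hlt hcap hlo hM⟩

end Legendre

/-! ### §6 Print-unit readers (appended 2026-08-26, same seat): Qin 2020 / Xu 2024 normalisation — printed field
`h_d = 4h`, printed per-bond pairing order `Δ_d(L, h_d) = m_L(h_d/4)/4` (`pinningFieldPairingOrder_eq`, cq-lit-2) — so a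
CQ-TABLE B cell in tree units reads against the printed `Δ_d(h_d)` curves BEFORE extrapolation (REFVALS-CQ) by one division. -/

section PrintUnits

variable {tp U μ hd : ℝ} {q L₀ : ℕ} {m M : ℚ}

/-- **Ceiling leaf ⇒ printed per-bond order ceiling**: a ceiling `M` at TREE field `h_d/4` gives
`Δ_d(L, h_d) = pinningFieldPairingOrder L tp U μ h_d ≤ M/4` on every side of the row (printed field `h_d`, Qin eq. (4)/(5),
Xu SM (16)–(17)). [cite: QinEtAl2020, eq. (4) p. 4] [cite: XuEtAl2024, SM eqs. (16)–(17) pp. 11–12] -/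
theorem PinFieldResponseCeilingAt.pinningFieldPairingOrder_le (hC : PinFieldResponseCeilingAt tp U μ (hd / 4) q L₀ M)
    (L : ℕ) [NeZero L] (hL : L₀ ≤ L) (hqL : q ∣ L) :
    pinningFieldPairingOrder L tp U μ hd ≤ ((M : ℚ) : ℝ) / 4 := by
  have h1 := hC L hL hqL
  unfold PinFieldTorusResponseCeiling at h1
  rw [pinningFieldPairingOrder_eq]
  linarith

/-- **Floor leaf ⇒ printed per-bond order floor**: a floor `m` at TREE field `h_d/4` gives `m/4 ≤ Δ_d(L, h_d)` on every side
of the row. (A finite-field response floor; not an order parameter.) [cite: QinEtAl2020, eq. (4) p. 4]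
[cite: XuEtAl2024, SM eqs. (16)–(17) pp. 11–12] -/
theorem PinFieldResponseFloorAt.le_pinningFieldPairingOrder (hF : PinFieldResponseFloorAt tp U μ (hd / 4) q L₀ m)
    (L : ℕ) [NeZero L] (hL : L₀ ≤ L) (hqL : q ∣ L) :
    ((m : ℚ) : ℝ) / 4 ≤ pinningFieldPairingOrder L tp U μ hd := by
  have h1 := hF L hL hqL
  unfold PinFieldTorusResponseFloor at h1
  rw [pinningFieldPairingOrder_eq]
  linarith

/-- **Window leaf in print units**: `Δ_d(L, h_d) ∈ [m/4, M/4]` on every side of the row; the printed extrapolated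
order parameters (`PinningFieldReport`, `treeValue = 4·value`) compare with `dWaveOrderParameterTT'` ceilings the same way
(`dWaveOrderParameterTT' ≤ M` ↔ printed-normalised `≤ M/4`). [cite: XuEtAl2024, §III.B p. 6] -/
theorem PinFieldResponseWindowAt.pinningFieldPairingOrder_mem_Icc (hW : PinFieldResponseWindowAt tp U μ (hd / 4) q L₀ m M)
    (L : ℕ) [NeZero L] (hL : L₀ ≤ L) (hqL : q ∣ L) :
    pinningFieldPairingOrder L tp U μ hd ∈ Set.Icc (((m : ℚ) : ℝ) / 4) (((M : ℚ) : ℝ) / 4) :=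
  ⟨hW.1.le_pinningFieldPairingOrder L hL hqL, hW.2.pinningFieldPairingOrder_le L hL hqL⟩

/-- The pilot grid in both units (decidable): tree `h ∈ {1/20, 1/10, 1/5}` is printed `h_d = 4h ∈ {1/5, 2/5, 4/5}`, and the
director's printed-looking `{0.05, 0.1, 0.2}` read as `h_d` is tree `{1/80, 1/40, 1/20}`. [cite: XuEtAl2024, SM eqs. (16)–(17) pp. 11–12] -/
theorem pinning_pilot_grid_units :
    (4 : ℝ) * (1 / 20) = 1 / 5 ∧ (4 : ℝ) * (1 / 10) = 2 / 5 ∧ (4 : ℝ) * (1 / 5) = 4 / 5 ∧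
      (0.05 : ℝ) / 4 = 1 / 80 ∧ (0.1 : ℝ) / 4 = 1 / 40 ∧ (0.2 : ℝ) / 4 = 1 / 20 := by
  norm_num

end PrintUnits

end Summit.Ventures.CertifiedManyBodySolver.Observables

end
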